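import Mathlib
import Summits.NavierStokesRegularity.NavierStokesRegularity.Theorems.ThreadingFluxPrecessionPrecessingHorizon
import HarnessLib

/-!
# Crux `PoloidalLiouville` (stmt-NavierStokesRegularity-1222, W1), crux idea «precession-gap» × «horizon-threading-tower» (ns-idea-15):
# PRECESSING HORIZON ZONALITY — on the precessing stratum the conclusion of `HorizonTowerZonality` holds WITHOUT the horizon laws

Support file (`--supports stmt-NavierStokesRegularity-1222`, helper).  Experiment cell `ns-wall-extremal`, width hand ns-wall-eng-4 g4.  0 kit.

`Precession.precessingHorizonZonality`: under the hypotheses of (J″) `Precession.precessingHorizonAxisymmetric` (a rotating wave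
about `x₀ + ℝe₃` with `Ω ≠ 0`, classical NS near `t = 0`, blow-down limit `(U, P₀)` of the slice `v 0` with `U ∈ C²`, `P₀ ∈ C¹` off
`0`) and the additional degree-0 homogeneity of `U` (`HorizonTower.IsZeroHomogeneousAbout 0 U`, as in the horizon card), the
radial part of the horizon profile has EXACTLY the zonal form concluded by the horizon card's conjecture `HorizonTowerZonality`
(`ThreadingFluxHorizonTowerDefs` l.261, with `x₀ = 0` and axis `a = e₃`):
`∃ a g, a ≠ 0 ∧ ∀ x ≠ 0, ⟪U x, x⟫ = ‖x‖ · g (⟪a, x⟫ / ‖x‖)`.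
So on the PRECESSING stratum the zonality of the horizon needs neither `𝔏₁[U] = 0` nor `𝔏₂[U] = 0`: it follows from the
time-periodic (rigidly rotating) structure alone ((J″)); on the STEADY stratum the horizon is even constant ((J′)).
Proof: rotation invariance `⟪U (R_θ z), R_θ z⟫ = ⟪U z, z⟫` ((J″)) + a polar angle `θ = arg (ξ₀ + i ξ₁)` carrying the meridian
point `(√(1 − s²), 0, s)`, `s = ξ₂`, to the direction `ξ = x/‖x‖`; `g s := ⟪U (√(1−s²), 0, s), (√(1−s²), 0, s)⟫`.

HONEST FRAME: information-grade, about hypothetical slowly precessing counterexamples' far fields; `HorizonTowerZonality` (general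
unthreaded profiles) remains a conjecture; `PoloidalLiouville` (1222) and NS regularity stay OPEN.
-/

-- the summit and its single problem share the name (D-0017 nested layout)
set_option linter.dupNamespace false

noncomputable section

namespace Summit.NavierStokesRegularity.NavierStokesRegularity.Theorems.PoloidalLiouville.Precession

open Set Function Filter Topology Metric
open scoped Topology RealInnerProductSpace Laplacian ContDiff
open Literature.Analysis.FluidPDE
open Summit.NavierStokesRegularity.NavierStokesRegularity.Theorems.PoloidalLiouville.HorizonTower (E3)

namespace PrecessingHorizon

/-- The meridian unit vector `(√(1 − s²), 0, s)` at height `s`. -/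
def meridian (s : ℝ) : E3 := WithLp.toLp 2 ![Real.sqrt (1 - s ^ 2), 0, s]

/-- First (horizontal) component of the meridian point: `√(1 − s²)`. -/
@[simp] theorem meridian_apply_zero (s : ℝ) : meridian s 0 = Real.sqrt (1 - s ^ 2) := rfl
/-- Second component of the meridian point: `0` (the meridian lies in the `x z`-plane). -/
@[simp] theorem meridian_apply_one (s : ℝ) : meridian s 1 = 0 := rfl
/-- Third (axial) component of the meridian point: `s`. -/
@[simp] theorem meridian_apply_two (s : ℝ) : meridian s 2 = s := rfl

/-- **Every unit vector is a rotation about the axis of the meridian point at its height**: for `‖ξ‖ = 1` there is an angle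
`θ` (the argument of `ξ₀ + i ξ₁`) with `R_θ (√(1 − ξ₂²), 0, ξ₂) = ξ`. -/
theorem exists_rotZ_meridian_eq {ξ : E3} (hξ : ‖ξ‖ = 1) : ∃ θ : ℝ, rotZ θ (meridian (ξ 2)) = ξ := by
  -- the horizontal modulus
  have hsq : ξ 0 ^ 2 + ξ 1 ^ 2 + ξ 2 ^ 2 = 1 := by
    have h := hξ
    rw [EuclideanSpace.norm_eq, Real.sqrt_eq_one, Fin.sum_univ_three] at h
    simpa only [Real.norm_eq_abs, sq_abs] using h
  have hρ : Real.sqrt (1 - ξ 2 ^ 2) = ‖(⟨ξ 0, ξ 1⟩ : ℂ)‖ := by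
    rw [Complex.norm_def, Complex.normSq_mk]
    congr 1
    nlinarith [hsq]
  refine ⟨Complex.arg ⟨ξ 0, ξ 1⟩, ?_⟩
  set θ : ℝ := Complex.arg ⟨ξ 0, ξ 1⟩ with hθ
  ext i
  fin_cases i
  · show rotZ θ (meridian (ξ 2)) 0 = ξ 0
    rw [rotZ_apply_zero, meridian_apply_zero, meridian_apply_one, mul_zero, sub_zero, hρ, mul_comm,
      Complex.norm_mul_cos_arg]
  · show rotZ θ (meridian (ξ 2)) 1 = ξ 1
    rw [rotZ_apply_one, meridian_apply_zero, meridian_apply_one, mul_zero, add_zero, hρ, mul_comm,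
      Complex.norm_mul_sin_arg]
  · show rotZ θ (meridian (ξ 2)) 2 = ξ 2
    rw [rotZ_apply_two, meridian_apply_two]

/-- The meridian point is a unit vector for `|s| ≤ 1`… indeed `‖meridian s‖ = 1` whenever `s² ≤ 1`. -/
theorem norm_meridian {s : ℝ} (hs : s ^ 2 ≤ 1) : ‖meridian s‖ = 1 := by
  rw [EuclideanSpace.norm_eq, Real.sqrt_eq_one, Fin.sum_univ_three]
  simp only [meridian_apply_zero, meridian_apply_one, meridian_apply_two, Real.norm_eq_abs, sq_abs]
  rw [Real.sq_sqrt (by linarith), zero_pow two_ne_zero]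
  ring

end PrecessingHorizon

/-- **PRECESSING HORIZON ZONALITY** — the conclusion of `HorizonTowerZonality` on the precessing stratum, without the horizon
laws.  Under the hypotheses of `precessingHorizonAxisymmetric` plus degree-0 homogeneity of the horizon profile `U`:
`∃ a g, a ≠ 0 ∧ ∀ x ≠ 0, ⟪U x, x⟫ = ‖x‖ · g (⟪a, x⟫/‖x‖)` (with `a = e₃`, the precession axis). -/
theorem precessingHorizonZonality (v : ℝ → E3 → E3) (p : ℝ → E3 → ℝ) (x₀ : E3) (Ω : ℝ) (V U : E3 → E3)
    (P₀ : E3 → ℝ) (S : Set ℝ) (hS : IsOpen S) (h0S : (0 : ℝ) ∈ S) (hNS : IsClassicalNSSolutionOn S 1 0 v p)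
    (hrw : ∀ t x, v t x = rotZ (Ω * t) (V (rotZ (-(Ω * t)) (x - x₀)))) (hΩ : Ω ≠ 0)
    (hU : ContDiffOn ℝ 2 U {0}ᶜ) (hP : ContDiffOn ℝ 1 P₀ {0}ᶜ)
    (hbd : HorizonTower.IsBlowdownLimit (v 0) (p 0) x₀ U P₀) (hhom : HorizonTower.IsZeroHomogeneousAbout 0 U) :
    ∃ (a : E3) (g : ℝ → ℝ), a ≠ 0 ∧ ∀ x : E3, x ≠ 0 → inner ℝ (U x) x = ‖x‖ * g (inner ℝ a x / ‖x‖) := by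
  obtain ⟨-, hzonal⟩ := precessingHorizonAxisymmetric v p x₀ Ω V U P₀ S hS h0S hNS hrw hΩ hU hP hbd
  set e₃ : E3 := EuclideanSpace.single (2 : Fin 3) (1 : ℝ) with he₃
  refine ⟨e₃, fun s => inner ℝ (U (PrecessingHorizon.meridian s)) (PrecessingHorizon.meridian s), ?_, fun x hx => ?_⟩
  · intro h
    have := congrArg (fun w : E3 => w 2) h
    simp [he₃] at this
  · have hnx : 0 < ‖x‖ := norm_pos_iff.mpr hx
    set ξ : E3 := ‖x‖⁻¹ • x with hξ
    have hξ1 : ‖ξ‖ = 1 := by rw [hξ, norm_smul, norm_inv, norm_norm, inv_mul_cancel₀ hnx.ne']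
    have hs : inner ℝ e₃ x / ‖x‖ = ξ 2 := by
      rw [he₃, EuclideanSpace.inner_single_left, hξ]
      simp [div_eq_inv_mul]
    -- `U x = U ξ` (degree-0 homogeneity) and `x = ‖x‖ • ξ`
    have hxξ : x = ‖x‖ • ξ := by rw [hξ, smul_smul, mul_inv_cancel₀ hnx.ne', one_smul]
    have hUx : U x = U ξ := by
      have h := hhom ‖x‖ hnx ξ
      rw [zero_add, zero_add, ← hxξ] at h
      exact h
    -- rotate the meridian point to `ξ`
    obtain ⟨θ, hθ⟩ := PrecessingHorizon.exists_rotZ_meridian_eq hξ1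
    have hm0 : PrecessingHorizon.meridian (ξ 2) ≠ 0 := by
      have hs2 : ξ 2 ^ 2 ≤ 1 := by
        have h := hξ1
        rw [EuclideanSpace.norm_eq, Real.sqrt_eq_one, Fin.sum_univ_three] at h
        simp only [Real.norm_eq_abs, sq_abs] at h
        nlinarith [sq_nonneg (ξ 0), sq_nonneg (ξ 1)]
      intro h0
      have h := PrecessingHorizon.norm_meridian hs2
      rw [h0, norm_zero] at h
      exact zero_ne_one h
    have hrot := hzonal θ (PrecessingHorizon.meridian (ξ 2)) hm0
    rw [hθ] at hrot
    rw [hs, hUx, hxξ, inner_smul_right, ← hxξ, hrot]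
end Summit.NavierStokesRegularity.NavierStokesRegularity.Theorems.PoloidalLiouville.Precession

end
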